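import Summits.BirchSwinnertonDyer.BirchSwinnertonDyer.Theorems.BiquadraticEisensteinDescentHeegnerTwistCouplingInSupplySqrtTwoCornerFifteen
import Literature.NumberTheory.EllipticCurves.BSDAnalyticRankTunnellCMProofs
import Literature.NumberTheory.EllipticCurves.AnalyticRankModularityProofs
import HarnessLib

set_option linter.dupNamespace false -- `Summit.BirchSwinnertonDyer.BirchSwinnertonDyer.Theorems.…` (summit = sub)
set_option autoImplicit false

/-!
# Crux `HeegnerTwistCouplingInSupply` (stmt-BirchSwinnertonDyer-21381) — the `j = 8000` corner `W = B_p`: the crux's instance binders are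
# SATISFIED (`B_p : y² = x³ + 4p x² + 2p² x` is a global minimal model for odd prime `p`, `N(B_p) ≠ 0`, `B_p` is elliptic), and the corner at
# every prime `p ≡ 15 (mod 16)` restated with `[IsElliptic]` as the only side binder

Route `BiquadraticEisensteinDescent` (cell `pub/bsd-wall`, width seat `bsd-wall-cm-bed-w2` g12; `--supports` 21381, helper). The corner
theorems `…SqrtTwoCorner.cruxOnBpCorner_of_two_facts` (bed-w1 g10, `p ≡ 5 (8)`) and `…SqrtTwoCornerFifteen.cruxOnBpCornerFifteen_of_two_facts`
(this seat, every `p ≡ 15 (16)`) mirror the crux's binders `[W.IsGloballyMinimal] [NeZero (W.conductorNorm ℤ)]` as unused instance arguments.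
This file shows they are inhabited for `W = B_p`, so the corner conclusions are honest closed statements about the curve `B_p`:

* `valuation_B_a_le_one`, `B_Δ` (`Δ = 2⁹p⁶`), `exp_neg_twelve_lt_valuation_B_Δ` (`ord_v Δ ∈ {9, 6, 0} < 12` at `v ∣ 2`, `v ∣ p`, else);
* ★ `isGloballyMinimal_B` — `B_p` is a global minimal Weierstrass equation for every odd prime `p` (integral + `ord_v Δ < 12` everywhere,
  Silverman VII.1 Remark 1.1 via the tree's `isMinimalAt_of_lt_valuation_Δ_holds`, exactly as `isGloballyMinimal_congruentNumberCurve`);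
* `neZero_conductorNorm_B` (`conductorNorm_pos_holds`), `isElliptic_Bp`;
* ★★ `cruxOnBpCornerFifteen` — for every prime `p ≡ 15 (mod 16)`: an imaginary quadratic `K′` with `4 < |d_{K′}|`, Heegner for `N(B_p)`,
  `L(B_p^{(d_{K′})}, 1) ≠ 0`, `h(K′) < p`, `p ∤ h(K′)`, modulo Burungale–Tian + Deuring–Hecke only, with `[Fact p.Prime] [IsElliptic]` as the
  only binders.

HONEST FRAMING: a sub-corner of one CM family; crux 21381 (all CM `W` of analytic rank one; residual C⁺) is NOT closed; BSD is not proved by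
any of this. THEOREMS ONLY; supports stmt-BirchSwinnertonDyer-21381.
-/

noncomputable section

open scoped Classical NumberField

namespace Summit.BirchSwinnertonDyer.BirchSwinnertonDyer.Theorems.BiquadraticEisensteinDescentHeegnerTwistCouplingInSupplySqrtTwoCornerFifteenMinimal

open _root_.WeierstrassCurve Literature.NumberTheory.EllipticCurves Literature.NumberTheory
open IsDedekindDomain Rat.HeightOneSpectrum
open Summit.BirchSwinnertonDyer.BirchSwinnertonDyer.Theorems.BiquadraticEisensteinDescentHeegnerTwistCouplingInSupplySqrtTwoCorner (isElliptic_Bfam)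
open Summit.BirchSwinnertonDyer.BirchSwinnertonDyer.Theorems.BiquadraticEisensteinDescentHeegnerTwistCouplingInSupplySqrtTwoCornerFifteen
  (cruxOnBpCornerFifteen_of_two_facts)

variable (v : HeightOneSpectrum (𝓞 ℚ))

/-- The coefficients of `B_p` are `v`-integral at every finite place. [folklore] -/
theorem valuation_B_a_le_one (p : ℕ) :
    v.valuation ℚ (⟨0, 4 * (p : ℚ), 0, 2 * (p : ℚ) ^ 2, 0⟩ : WeierstrassCurve ℚ).a₁ ≤ 1 ∧
      v.valuation ℚ (⟨0, 4 * (p : ℚ), 0, 2 * (p : ℚ) ^ 2, 0⟩ : WeierstrassCurve ℚ).a₂ ≤ 1 ∧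
      v.valuation ℚ (⟨0, 4 * (p : ℚ), 0, 2 * (p : ℚ) ^ 2, 0⟩ : WeierstrassCurve ℚ).a₃ ≤ 1 ∧
      v.valuation ℚ (⟨0, 4 * (p : ℚ), 0, 2 * (p : ℚ) ^ 2, 0⟩ : WeierstrassCurve ℚ).a₄ ≤ 1 ∧
      v.valuation ℚ (⟨0, 4 * (p : ℚ), 0, 2 * (p : ℚ) ^ 2, 0⟩ : WeierstrassCurve ℚ).a₆ ≤ 1 := by
  refine ⟨by simp, ?_, by simp, ?_, by simp⟩
  · rw [show (4 * (p : ℚ)) = ((4 * p : ℕ) : ℚ) by push_cast; ring, GaloisRepresentations.Rat.valuation_natCast]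
    exact HeightOneSpectrum.intValuation_le_one _ _
  · rw [show (2 * (p : ℚ) ^ 2) = ((2 * p ^ 2 : ℕ) : ℚ) by push_cast; ring, GaloisRepresentations.Rat.valuation_natCast]
    exact HeightOneSpectrum.intValuation_le_one _ _

/-- `Δ(B_p) = 2⁹ p⁶` in `ℚ`. [cite: SilvermanAEC2009, III.1 (b₂, b₄, b₆, b₈, Δ)] -/
theorem B_Δ (p : ℕ) : (⟨0, 4 * (p : ℚ), 0, 2 * (p : ℚ) ^ 2, 0⟩ : WeierstrassCurve ℚ).Δ = ((2 : ℕ) : ℚ) ^ 9 * ((p : ℕ) : ℚ) ^ 6 := by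
  simp only [WeierstrassCurve.Δ, WeierstrassCurve.b₂, WeierstrassCurve.b₄, WeierstrassCurve.b₆, WeierstrassCurve.b₈]
  push_cast
  ring

/-- **`ord_v Δ(B_p) < 12` at every finite place** for an odd prime `p`: `Δ = 2⁹ p⁶`, so `ord₂ Δ = 9`, `ord_p Δ = 6`, `ord_v Δ = 0`
elsewhere. [cite: SilvermanAEC2009, VII.1 Remark 1.1] -/
theorem exp_neg_twelve_lt_valuation_B_Δ {p : ℕ} (hp : p.Prime) (hp2 : p ≠ 2) :
    WithZero.exp (-12 : ℤ) < v.valuation ℚ (⟨0, 4 * (p : ℚ), 0, 2 * (p : ℚ) ^ 2, 0⟩ : WeierstrassCurve ℚ).Δ := by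
  rw [B_Δ, map_mul, map_pow, map_pow]
  by_cases hv : natGenerator v = 2
  · -- `|2| = exp(−1)`, `|p| = 1`
    have h2 : v.valuation ℚ ((2 : ℕ) : ℚ) = WithZero.exp (-1 : ℤ) := by
      rw [← hv]; exact GaloisRepresentations.Rat.valuation_natGenerator v
    have hpv : v.valuation ℚ ((p : ℕ) : ℚ) = 1 := by
      rw [show ((p : ℕ) : ℚ) = ((p : ℤ) : ℚ) by norm_num]
      refine GaloisRepresentations.Rat.valuation_intCast_eq_one v fun h => hp2 ?_
      rw [hv] at h
      exact ((Nat.prime_dvd_prime_iff_eq Nat.prime_two hp).mp (by exact_mod_cast h)).symm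
    rw [h2, hpv, one_pow, mul_one, ← WithZero.exp_nsmul, WithZero.exp_lt_exp]
    norm_num
  · -- `|2| = 1`, `|p| ∈ {exp(−1), 1}`
    have h2 : v.valuation ℚ ((2 : ℕ) : ℚ) = 1 := by
      rw [show ((2 : ℕ) : ℚ) = ((2 : ℤ) : ℚ) by norm_num]
      refine GaloisRepresentations.Rat.valuation_intCast_eq_one v fun h => hv ?_
      exact (Nat.prime_dvd_prime_iff_eq (prime_natGenerator v) Nat.prime_two).mp (by exact_mod_cast h)
    rw [h2, one_pow, one_mul]
    by_cases hvp : natGenerator v = p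
    · have hpv : v.valuation ℚ ((p : ℕ) : ℚ) = WithZero.exp (-1 : ℤ) := by
        rw [← hvp]; exact GaloisRepresentations.Rat.valuation_natGenerator v
      rw [hpv, ← WithZero.exp_nsmul, WithZero.exp_lt_exp]
      norm_num
    · have hpv : v.valuation ℚ ((p : ℕ) : ℚ) = 1 := by
        rw [show ((p : ℕ) : ℚ) = ((p : ℤ) : ℚ) by norm_num]
        refine GaloisRepresentations.Rat.valuation_intCast_eq_one v fun h => hvp ?_
        exact (Nat.prime_dvd_prime_iff_eq (prime_natGenerator v) hp).mp (by exact_mod_cast h)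
      rw [hpv, one_pow, ← WithZero.exp_zero, WithZero.exp_lt_exp]
      norm_num

/-- ★ **`B_p : y² = x³ + 4p x² + 2p² x` is a global minimal Weierstrass equation** for every odd prime `p` (integral, and `ord_v Δ < 12` at
every place — Silverman VII.1 Remark 1.1 via the tree's `isMinimalAt_of_lt_valuation_Δ_holds`). So the crux binder `[W.IsGloballyMinimal]`
is satisfied by `W = B_p`. [cite: SilvermanAEC2009, VII.1 Remark 1.1 and VIII.8] -/
theorem isGloballyMinimal_B {p : ℕ} (hp : p.Prime) (hp2 : p ≠ 2) :
    (⟨0, 4 * (p : ℚ), 0, 2 * (p : ℚ) ^ 2, 0⟩ : WeierstrassCurve ℚ).IsGloballyMinimal where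
  isIntegral := isIntegral_of_exists_lift _ ⟨0, by simp⟩ ⟨((4 * p : ℕ) : 𝓞 ℚ), by rw [map_natCast]; push_cast; ring⟩
    ⟨0, by simp⟩ ⟨((2 * p ^ 2 : ℕ) : 𝓞 ℚ), by rw [map_natCast]; push_cast; ring⟩ ⟨0, by simp⟩
  isMinimal v := by
    obtain ⟨h₁, h₂, h₃, h₄, h₆⟩ := valuation_B_a_le_one v p
    exact isMinimalAt_of_lt_valuation_Δ_holds
      ((⟨0, 4 * (p : ℚ), 0, 2 * (p : ℚ) ^ 2, 0⟩ : WeierstrassCurve ℚ).isIntegralAt_of_valuation_le_one v h₁ h₂ h₃ h₄ h₆)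
      (exp_neg_twelve_lt_valuation_B_Δ v hp hp2)

/-- `N(B_p) ≠ 0` (the crux binder `[NeZero (W.conductorNorm ℤ)]`; tree theorem `conductorNorm_pos_holds`). [folklore] -/
theorem neZero_conductorNorm_B (p : ℕ) [(⟨0, 4 * (p : ℚ), 0, 2 * (p : ℚ) ^ 2, 0⟩ : WeierstrassCurve ℚ).IsElliptic] :
    NeZero ((⟨0, 4 * (p : ℚ), 0, 2 * (p : ℚ) ^ 2, 0⟩ : WeierstrassCurve ℚ).conductorNorm ℤ) :=
  ⟨((⟨0, 4 * (p : ℚ), 0, 2 * (p : ℚ) ^ 2, 0⟩ : WeierstrassCurve ℚ).conductorNorm_pos_holds).ne'⟩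

/-- ★★ **The `j = 8000` corner at every prime `p ≡ 15 (mod 16)`, with no side binders**: for `W = B_p` (an elliptic curve — the only
remaining instance argument, inhabited by `…SqrtTwoCorner.isElliptic_Bfam`) there is an imaginary quadratic `K′` with `4 < |d_{K′}|`, Heegner
for `N(B_p)`, `L(B_p^{(d_{K′})}, 1) ≠ 0`, `h(K′) < p`, `p ∤ h(K′)` — modulo Burungale–Tian + Deuring–Hecke only (`…SqrtTwoCornerFifteen` with
the binders `IsGloballyMinimal`, `NeZero N` discharged by `isGloballyMinimal_B`, `neZero_conductorNorm_B`). HONEST FRAMING: a sub-corner of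
one CM family; crux 21381 (all CM `W` of analytic rank one) is NOT closed; BSD is not proved by this.
[cite: BurungaleTian2026, Thm. 1.1] [cite: SilvermanATAEC1994, Ch. II Cor. 10.5.1] [cite: SilvermanAEC2009, Prop. X.4.9 and VII.1 Remark 1.1] -/
theorem cruxOnBpCornerFifteen (hBT : burungaleTian_analyticRank_eq_zero_of_selmerCorank_eq_zero_of_hasCM)
    (hH : hasEntireLFunction_of_j_mem_maximalCMJInvariants) :
    ∀ (p : ℕ) [Fact p.Prime] [(⟨0, 4 * (p : ℚ), 0, 2 * (p : ℚ) ^ 2, 0⟩ : WeierstrassCurve ℚ).IsElliptic], p % 16 = 15 →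
      ∃ (K : Type) (_ : Field K) (_ : NumberField K),
        IsImaginaryQuadratic K ∧ 4 < (NumberField.discr K).natAbs ∧
        SatisfiesHeegnerHypothesis ((⟨0, 4 * (p : ℚ), 0, 2 * (p : ℚ) ^ 2, 0⟩ : WeierstrassCurve ℚ).conductorNorm ℤ) K ∧
        ((⟨0, 4 * (p : ℚ), 0, 2 * (p : ℚ) ^ 2, 0⟩ : WeierstrassCurve ℚ).quadraticTwist
          (NumberField.discr K : ℚ)).entireLFunction 1 ≠ 0 ∧
        NumberField.classNumber K < p ∧ ¬ p ∣ NumberField.classNumber K := by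
  intro p hpF _ hp16
  haveI := isGloballyMinimal_B hpF.out (by rintro rfl; omega)
  haveI := neZero_conductorNorm_B p
  exact cruxOnBpCornerFifteen_of_two_facts hBT hH p hp16

/-- `B_p` is an elliptic curve for every prime `p` (so even the last binder is inhabited). [folklore] -/
theorem isElliptic_Bp (p : ℕ) [Fact p.Prime] : (⟨0, 4 * (p : ℚ), 0, 2 * (p : ℚ) ^ 2, 0⟩ : WeierstrassCurve ℚ).IsElliptic :=
  isElliptic_Bfam (by exact_mod_cast (Fact.out : p.Prime).ne_zero)

end Summit.BirchSwinnertonDyer.BirchSwinnertonDyer.Theorems.BiquadraticEisensteinDescentHeegnerTwistCouplingInSupplySqrtTwoCornerFifteenMinimal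

end
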